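import Mathlib.FieldTheory.Fixed
import Mathlib.Topology.Algebra.OpenSubgroup
import Mathlib.Topology.Algebra.ContinuousMonoidHom
import Mathlib.Topology.Algebra.Category.ProfiniteGrp.Basic
import Mathlib.GroupTheory.QuotientGroup.Defs
import Mathlib.Algebra.Group.Subgroup.Pointwise
import Literature.IUT.HodgeTheaters.Labels
import HarnessLib

/-!
# [IUTchI] Example 5.1 (i): global Frobenioids — the number-field data reconstructed from `π₁(†𝒟^⊚)`

Mochizuki, *Inter-universal Teichmüller theory I*, §5 "ΘNF-Hodge theaters", Example 5.1 "Global
Frobenioids", part (i), kurims manuscript (May 2020) pp. 123–125 ([IUTchI] Ex 5.1 (i) pp.123–125)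
[claim: Mochizuki2012, status: disputed].  STATEMENTS-FIRST over an INTERFACE; nothing asserted.

**What (i) says.**  Let `†HT^{𝒟-ΘNF} = (†𝒟^⊚ ← †𝔇_J → †𝔇_>)` be a `𝒟`-ΘNF-Hodge theater (Def. 4.6).
Applying [AbsTopIII] Thm 1.9 "via the Θ-approach" (Rmk 3.1.2) to `π₁(†𝒟^⊚)` one constructs
group-theoretically: an isomorph `𝕄^⊛(†𝒟^⊚)` of `F̄^×` with its `π₁(†𝒟^⊚)`-action and the field
structure on `𝕄̄^⊛ := 𝕄^⊛ ∪ {0}`; a profinite group "corresponding to `C_{F_mod}`" containing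
`π₁(†𝒟^⊚)` as an open subgroup, `†𝒟^⊛ := ℬ(−)⁰` of it, the natural `†𝒟^⊚ → †𝒟^⊛` and the extension
of the action to `π₁(†𝒟^⊛)`; the invariants `𝕄^⊛_mod ⊆ 𝕄^⊛` (= `F^×_mod ⊆ F̄^×`); an isomorph
`π₁^rat(†𝒟^⊛) ↠ π₁(†𝒟^⊛)` of the absolute Galois group of the function field of `C_{F_mod}`; the
pseudo-monoids `𝕄^⊛_κ, 𝕄^⊛_∞κ, 𝕄^⊛_∞κ×` of `κ`-, `∞κ`-, `∞κ×`-coric rational functions (Rmk 3.1.7)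
with `π₁^rat`-actions; the quotient `π₁^rat ↠ π₁^{κ-sol}` with kernel `π₁^{rat/κ-sol}` := (kernel of
the action on `𝕄^⊛_∞κ`) ∩ (inverse image of the kernel of `G_{F_mod} ↠ G^{sol}_{F_mod}`); the
invariants `𝕄^⊛_{κ-sol}, 𝕄^⊛_sol`; subgroups `Aut^SL_ε(†𝒟^⊚) ⊆ Aut^SL(†𝒟^⊚) ⊆ Aut(†𝒟^⊚)` with
`Aut^SL/Aut^SL_ε ⥲ Aut/Aut_ε ⥲ 𝔽_l^⋇` (a poly-action of `𝔽_l^⋇`); and the phenomenon of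
**κ-sol-conjugate synchronization**: the resulting poly-action of `𝔽_l^⋇` on `π₁^rat(†𝒟^⊛)` is
well-defined up to `π₁^{rat/κ-sol}(†𝒟^⊚)`-conjugacy and induces the TRIVIAL action on the
`κ-sol`-outer representation `π₁^{κ-sol}(†𝒟^⊛) → Out(π₁^{rat/κ-sol}(†𝒟^⊛))`.

**Typing.**  The reconstruction itself is [AbsTopIII] Thm 1.9 / [AbsTopII] Cor 3.3 — owned by
seats abc-iut-L4-t1 / -t4 and, per the L4 ruling θ (INBOX 18:28Z), consumed here through its
OUTPUT: the structure `NFBridgeRecon` records the reconstructed objects as DATA (profinite groups as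
Mathlib `ProfiniteGrp`, the field `𝕄̄^⊛` as a Mathlib `Field` with a `MulSemiringAction`, the coric
pseudo-monoids as subsets of a field with `π₁^rat`-action — TODO-merge:abc-iut-L4-t1 [AbsTopIII]
Thm 1.9, abc-iut-L5-t3 Def 4.1 (v)/Ex 4.3 for `†𝒟^⊚` and `Aut_ε`).  Everything the text then
DEFINES from these objects is a real definition here: `MbarMod` (fixed field), `ratCirc`
(`π₁^rat(†𝒟^⊚)` as a fibre product), `actionKer`, `ratKsolKer` (`π₁^{rat/κ-sol}`), `ratKsolCirc`,
`MκSol`, `Msol`.  The printed claims are predicates: `FlStarPolyAction` (the two isomorphisms with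
`𝔽_l^⋇`), `KappaSolConjugateSynchronization`.  Parts (ii)–(vii) and Remarks 5.1.1–5.1.5 are in the
sibling files `GlobalFrobenioidsModel.lean`, `GlobalFrobenioidsKummer.lean`.
No printed statement is strengthened; no side is taken.
-/

namespace Literature.IUT.HodgeTheaters

open Pointwise Topology

universe u

/-! ### The reconstructed data (Ex. 5.1 (i), pp. 123–124) -/

/-- INTERFACE DATA for [IUTchI] Example 5.1 (i) (pp. 123–124): the objects constructed
group-theoretically from `π₁(†𝒟^⊚)` — `π₁(†𝒟^⊛) ⊇ π₁(†𝒟^⊚)` (open), the field `𝕄̄^⊛(†𝒟^⊚) ≅ F̄` with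
its natural (smooth) `π₁(†𝒟^⊛)`-action, `π₁^rat(†𝒟^⊛) ↠ π₁(†𝒟^⊛)`, a field of rational functions with
smooth `π₁^rat`-action containing the constants and the coric pseudo-monoids
`𝕄^⊛_κ ⊆ 𝕄^⊛_∞κ ⊆ 𝕄^⊛_∞κ×`, the kernel of `π₁(†𝒟^⊛) ↠ G_{F_mod} ↠ G_{F_mod}^{sol}`, and the groups
`Aut_ε, Aut^SL_ε ⊆ Aut^SL ⊆ Aut(†𝒟^⊚)` with chosen liftings of `Aut^SL` to automorphisms of
`π₁^rat(†𝒟^⊛)` (the poly-action "only well-defined up to conjugation").  TODO-merge: abc-iut-L4-t1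
([AbsTopIII] Thm 1.9 output), abc-iut-L5-t3 (Def 4.1 (v), Ex 4.3 (i)).
([IUTchI] Ex 5.1 (i) p.123) [claim: Mochizuki2012, status: disputed] -/
structure NFBridgeRecon : Type (u + 1) where
  /-- the prime `l` of the initial Θ-data -/
  l : ℕ
  /-- `π₁(†𝒟^⊛)` ("a profinite group corresponding to `C_{F_mod}`") and its open subgroup `π₁(†𝒟^⊚)` -/
  piDast : ProfiniteGrp.{u}
  piDcirc : OpenSubgroup piDast
  /-- `𝕄̄^⊛(†𝒟^⊚) = 𝕄^⊛ ∪ {0}` (an isomorph of `F̄`) with its natural `π₁(†𝒟^⊛)`-action -/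
  Fbar : Type u
  [fbarField : Field Fbar]
  [fbarAction : MulSemiringAction piDast Fbar]
  isOpen_stabilizer_fbar : ∀ x : Fbar, IsOpen (MulAction.stabilizer piDast x : Set piDast)
  /-- `π₁^rat(†𝒟^⊛) ↠ π₁(†𝒟^⊛)` (absolute Galois group of the function field of `C_{F_mod}`) -/
  piRat : ProfiniteGrp.{u}
  ratToAst : piRat →ₜ* piDast
  ratToAst_surjective : Function.Surjective ratToAst
  /-- a field of rational functions with smooth `π₁^rat`-action, receiving the constants
  equivariantly, inside which the coric pseudo-monoids live -/
  Krat : Type u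
  [kratField : Field Krat]
  [kratAction : MulSemiringAction piRat Krat]
  isOpen_stabilizer_krat : ∀ f : Krat, IsOpen (MulAction.stabilizer piRat f : Set piRat)
  const : Fbar →+* Krat
  const_smul : ∀ (g : piRat) (x : Fbar), const (ratToAst g • x) = g • const x
  /-- `𝕄^⊛_κ ⊆ 𝕄^⊛_∞κ ⊆ 𝕄^⊛_∞κ×` (κ-, ∞κ-, ∞κ×-coric rational functions, Rmk 3.1.7), stable under
  `π₁^rat`, consisting of nonzero functions -/
  Mκ : Set Krat
  Minfκ : Set Krat
  Minfκx : Set Krat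
  mκ_subset : Mκ ⊆ Minfκ
  minfκ_subset : Minfκ ⊆ Minfκx
  zero_notMem : (0 : Krat) ∉ Minfκx
  smul_mem_minfκ : ∀ (g : piRat) {f : Krat}, f ∈ Minfκ → g • f ∈ Minfκ
  smul_mem_minfκx : ∀ (g : piRat) {f : Krat}, f ∈ Minfκx → g • f ∈ Minfκx
  /-- the [closed normal] kernel of `π₁(†𝒟^⊛) ↠ G_{F_mod} ↠ G^{sol}_{F_mod}` -/
  solKer : Subgroup piDast
  solKer_normal : solKer.Normal
  /-- `Aut_ε(†𝒟^⊚), Aut^SL_ε(†𝒟^⊚) ⊆ Aut^SL(†𝒟^⊚) ⊆ Aut(†𝒟^⊚)` (cf. Ex 4.3 (i), Rmk 3.1.7 (iii)) with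
  chosen liftings of the elements of `Aut^SL` to automorphisms of `π₁^rat(†𝒟^⊛)` -/
  AutD : Type u
  [autGroup : Group AutD]
  Autε : Subgroup AutD
  AutSL : Subgroup AutD
  AutSLε : Subgroup AutD
  autSLε_le : AutSLε ≤ AutSL
  autSLε_le_autε : AutSLε ≤ Autε
  lift : AutSL → (piRat ≃ₜ* piRat)

namespace NFBridgeRecon

attribute [instance] fbarField fbarAction kratField kratAction autGroup

variable (N : NFBridgeRecon.{u})

/-! ### What the text defines from the data (pp. 123–124) -/

/-- `𝕄^⊛(†𝒟^⊚)`: the nonzero elements of the field `𝕄̄^⊛` ("`𝕄̄^⊛ := 𝕄^⊛ ∪ {0}`", p. 123).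
([IUTchI] Ex 5.1 (i) p.123) [claim: Mochizuki2012, status: disputed] -/
abbrev Mast : Type u := N.Fbarˣ

/-- `𝕄̄^⊛_mod(†𝒟^⊚) ⊆ 𝕄̄^⊛(†𝒟^⊚)`: the subfield of `π₁(†𝒟^⊛)`-invariants, "corresponding to
`F_mod ⊆ F̄`" (p. 123). ([IUTchI] Ex 5.1 (i) p.123) [claim: Mochizuki2012, status: disputed] -/
def MbarMod : Subfield N.Fbar := FixedPoints.subfield N.piDast N.Fbar

/-- `𝕄^⊛_mod(†𝒟^⊚) ⊆ 𝕄^⊛(†𝒟^⊚)`: the submonoid of `π₁(†𝒟^⊛)`-invariant nonzero elements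
("corresponding to `F^×_mod ⊆ F̄^×`", p. 123). ([IUTchI] Ex 5.1 (i) p.123)
[claim: Mochizuki2012, status: disputed] -/
def Mmod : Subgroup N.Mast where
  carrier := {x | ∀ g : N.piDast, g • (x : N.Fbar) = x}
  one_mem' := fun g => by simp
  mul_mem' := fun {a b} ha hb g => by simp [smul_mul', ha g, hb g]
  inv_mem' := fun {a} ha g => by
    have h := ha g
    rw [Units.val_inv_eq_inv_val, smul_inv'', h]

/-- `𝕄^⊛_κ` is the subset of `π₁^rat`-invariants of `𝕄^⊛_∞κ` (p. 124: "may be identified with"),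
typed as the printed identification, a predicate on the data. ([IUTchI] Ex 5.1 (i) p.124)
[claim: Mochizuki2012, status: disputed] -/
@[mk_iff] structure MκIsInvariants : Prop where
  eq : N.Mκ = {f ∈ N.Minfκ | ∀ g : N.piRat, g • f = f}

/-- `𝕄^⊛` is identified with a sub-pseudo-monoid of `𝕄^⊛_∞κ×` (p. 124: the constants are
`∞κ×`-coric), a predicate on the data. ([IUTchI] Ex 5.1 (i) p.124)
[claim: Mochizuki2012, status: disputed] -/
@[mk_iff] structure ConstantsInfκx : Prop where
  mem : ∀ x : N.Mast, N.const (x : N.Fbar) ∈ N.Minfκx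

/-- The kernel of the action of `π₁^rat(†𝒟^⊛)` on `𝕄^⊛_∞κ(†𝒟^⊚)` (p. 124).
([IUTchI] Ex 5.1 (i) p.124) [claim: Mochizuki2012, status: disputed] -/
def actionKer : Subgroup N.piRat where
  carrier := {g | ∀ f ∈ N.Minfκ, g • f = f}
  one_mem' := fun f _ => one_smul _ f
  mul_mem' := fun {a b} ha hb f hf => by rw [mul_smul, hb f hf, ha f hf]
  inv_mem' := fun {a} ha f hf => by
    have h := ha f hf
    conv_lhs => rw [← h]
    rw [inv_smul_smul]

/-- `π₁^{rat/κ-sol}(†𝒟^⊛)`: the kernel of `π₁^rat(†𝒟^⊛) ↠ π₁^{κ-sol}(†𝒟^⊛)`, i.e. "the intersection of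
the kernel of the action of `π₁^rat(†𝒟^⊛)` on `𝕄^⊛_∞κ(†𝒟^⊚)` with the inverse image in
`π₁^rat(†𝒟^⊛)` of the kernel of the maximal solvable quotient of [the quotient corresponding to] the
absolute Galois group of `F_mod`" (p. 124). ([IUTchI] Ex 5.1 (i) p.124)
[claim: Mochizuki2012, status: disputed] -/
def ratKsolKer : Subgroup N.piRat := N.actionKer ⊓ N.solKer.comap N.ratToAst.toMonoidHom

/-- `π₁^rat(†𝒟^⊚) := π₁^rat(†𝒟^⊛) ×_{π₁(†𝒟^⊛)} π₁(†𝒟^⊚)` (p. 124). ([IUTchI] Ex 5.1 (i) p.124)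
[claim: Mochizuki2012, status: disputed] -/
def ratCirc : Subgroup N.piRat := (N.piDcirc : Subgroup N.piDast).comap N.ratToAst.toMonoidHom

/-- `π₁^{rat/κ-sol}(†𝒟^⊚) := π₁^{rat/κ-sol}(†𝒟^⊛) ∩ π₁^rat(†𝒟^⊚)` (p. 124). ([IUTchI] Ex 5.1 (i) p.124)
[claim: Mochizuki2012, status: disputed] -/
def ratKsolCirc : Subgroup N.piRat := N.ratKsolKer ⊓ N.ratCirc

/-- `𝕄^⊛_{κ-sol}(†𝒟^⊚)`: the `π₁^{rat/κ-sol}(†𝒟^⊛)`-invariants of `𝕄^⊛_∞κ×(†𝒟^⊚)` (p. 124).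
([IUTchI] Ex 5.1 (i) p.124) [claim: Mochizuki2012, status: disputed] -/
def MκSol : Set N.Krat := {f ∈ N.Minfκx | ∀ g ∈ N.ratKsolKer, g • f = f}

/-- `𝕄^⊛_sol(†𝒟^⊚)`: the `π₁^{rat/κ-sol}(†𝒟^⊛)`-invariants of `𝕄^⊛(†𝒟^⊚)` [acting through
`π₁^rat ↠ π₁(†𝒟^⊛)`] ("`F^×_sol`", p. 124). ([IUTchI] Ex 5.1 (i) p.124)
[claim: Mochizuki2012, status: disputed] -/
def Msol : Subgroup N.Mast where
  carrier := {x | ∀ g ∈ N.ratKsolKer, N.ratToAst g • (x : N.Fbar) = x}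
  one_mem' := fun g _ => by simp
  mul_mem' := fun {a b} ha hb g hg => by simp [smul_mul', ha g hg, hb g hg]
  inv_mem' := fun {a} ha g hg => by
    have h := ha g hg
    rw [Units.val_inv_eq_inv_val, smul_inv'', h]

/-- `𝕄^⊛_mod ⊆ 𝕄^⊛_sol` (invariants of the whole group are invariants of a subgroup).
([IUTchI] Ex 5.1 (i) p.124) [claim: Mochizuki2012, status: disputed] -/
theorem mmod_le_msol : N.Mmod ≤ N.Msol := fun _ hx g _ => hx (N.ratToAst g)

/-- `π₁^{rat/κ-sol}(†𝒟^⊚) ≤ π₁^{rat/κ-sol}(†𝒟^⊛)`. ([IUTchI] Ex 5.1 (i) p.124)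
[claim: Mochizuki2012, status: disputed] -/
theorem ratKsolCirc_le : N.ratKsolCirc ≤ N.ratKsolKer := inf_le_left

/-- The action kernel is normal, because `𝕄^⊛_∞κ` is `π₁^rat`-stable. ([IUTchI] Ex 5.1 (i) p.124)
[claim: Mochizuki2012, status: disputed] -/
theorem actionKer_normal : N.actionKer.Normal := by
  refine ⟨fun n hn g f hf => ?_⟩
  rw [mul_smul, mul_smul, hn _ (N.smul_mem_minfκ g⁻¹ hf), smul_inv_smul]

/-- `π₁^{rat/κ-sol}(†𝒟^⊛)` is normal in `π₁^rat(†𝒟^⊛)` [so the quotient `π₁^{κ-sol}(†𝒟^⊛)` is a group].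
([IUTchI] Ex 5.1 (i) p.124) [claim: Mochizuki2012, status: disputed] -/
instance ratKsolKer_normal : N.ratKsolKer.Normal := by
  haveI := N.actionKer_normal
  haveI : (N.solKer.comap N.ratToAst.toMonoidHom).Normal :=
    haveI := N.solKer_normal; Subgroup.Normal.comap inferInstance _
  exact Subgroup.normal_inf_normal _ _

/-- `π₁^{κ-sol}(†𝒟^⊛) := π₁^rat(†𝒟^⊛) / π₁^{rat/κ-sol}(†𝒟^⊛)`, "a quotient that corresponds to
`Gal(L̄_C/L_C) ↠ Gal(L_C(κ-sol)/L_C)` of Remark 3.1.7 (iv)" (p. 124). ([IUTchI] Ex 5.1 (i) p.124)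
[claim: Mochizuki2012, status: disputed] -/
abbrev PiKsol : Type u := N.piRat ⧸ N.ratKsolKer

/-! ### The printed claims of (i) as predicates (pp. 124–125) -/

/-- The poly-action of `𝔽_l^⋇` on `†𝒟^⊚` (p. 124): `Aut_ε ⊆ Aut` and `Aut^SL_ε ⊆ Aut^SL` are normal and the
natural maps `Aut^SL/Aut^SL_ε → Aut/Aut_ε → 𝔽_l^⋇` are isomorphisms (Ex 4.3 (i) for the second).  A
predicate on the data, not asserted. ([IUTchI] Ex 5.1 (i) p.124) [claim: Mochizuki2012, status: disputed] -/
structure FlStarPolyAction : Prop where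
  autε_normal : N.Autε.Normal
  autSLε_normal : (N.AutSLε.subgroupOf N.AutSL).Normal
  /-- `Aut^SL ∩ Aut_ε = Aut^SL_ε` and `Aut^SL · Aut_ε = Aut`, i.e. `Aut^SL/Aut^SL_ε ⥲ Aut/Aut_ε` -/
  inf_eq : N.AutSL ⊓ N.Autε = N.AutSLε
  sup_eq : N.AutSL ⊔ N.Autε = ⊤
  /-- `Aut/Aut_ε ⥲ 𝔽_l^⋇` -/
  quotient_equiv : ∀ [N.Autε.Normal], Nonempty (N.AutD ⧸ N.Autε ≃* FlStar N.l)

/-- **κ-sol-conjugate synchronization** (p. 125), for the data `N`: for every `a ∈ Aut^SL(†𝒟^⊚)`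
the chosen lifting `α` of `a` to `π₁^rat(†𝒟^⊛)` — which is only well-defined up to
`π₁^rat(†𝒟^⊚)`-conjugacy — is, up to `π₁^{rat/κ-sol}(†𝒟^⊚)`-conjugacy, independent of the choices,
and the induced action on [the domain, codomain, and arrow of] the `κ-sol`-outer representation
`π₁^{κ-sol}(†𝒟^⊛) → Out(π₁^{rat/κ-sol}(†𝒟^⊛))` is TRIVIAL: `α` preserves `π₁^{rat/κ-sol}(†𝒟^⊛)`, acts as
the identity on the quotient `π₁^{κ-sol}(†𝒟^⊛)`, and restricts to an inner automorphism [by an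
element of `π₁^{rat/κ-sol}(†𝒟^⊛)`] of `π₁^{rat/κ-sol}(†𝒟^⊛)`.  A predicate on the data, not asserted.
([IUTchI] Ex 5.1 (i) p.125) [claim: Mochizuki2012, status: disputed] -/
structure KappaSolConjugateSynchronization : Prop where
  /-- the lifting preserves `π₁^{rat/κ-sol}(†𝒟^⊛)` -/
  map_ratKsolKer : ∀ (a : N.AutSL) (g : N.piRat), g ∈ N.ratKsolKer ↔ N.lift a g ∈ N.ratKsolKer
  /-- any two liftings compatible with the indeterminacy differ by `π₁^{rat/κ-sol}(†𝒟^⊚)`-conjugation: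
  here, liftings of the same `a` along `Aut^SL_ε`-translates -/
  indeterminacy : ∀ (a b : N.AutSL), (a : N.AutD)⁻¹ * b ∈ N.AutSLε →
    ∃ n ∈ N.ratKsolCirc, ∀ g : N.piRat, N.lift b g = n * N.lift a g * n⁻¹
  /-- trivial on the quotient `π₁^{κ-sol}(†𝒟^⊛)` -/
  trivial_on_quotient : ∀ (a : N.AutSL) (g : N.piRat), (N.lift a g) * g⁻¹ ∈ N.ratKsolKer
  /-- inner on `π₁^{rat/κ-sol}(†𝒟^⊛)` -/
  inner_on_kernel : ∀ a : N.AutSL, ∃ n ∈ N.ratKsolKer, ∀ g ∈ N.ratKsolKer, N.lift a g = n * g * n⁻¹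

end NFBridgeRecon

end Literature.IUT.HodgeTheaters
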